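import Mathlib
import Summits.Ventures.PercRepro2.Defs
import Summits.Ventures.PercRepro2.Graph
import Summits.Ventures.PercRepro2.Harris
import Summits.Ventures.PercRepro2.Induced
import Summits.Ventures.PercRepro2.SideDefs
import Summits.Ventures.PercRepro2.SideLogSupermod
import Summits.Ventures.PercRepro2.SideCluster
import Summits.Ventures.PercRepro2.HullTree
import Summits.Ventures.PercRepro2.ForestCluster
import Summits.Ventures.PercRepro2.WForm
import Summits.Ventures.PercRepro2.WFormLSM
import Summits.Ventures.PercRepro2.WStatus

/-!
# The W-inequality holds for log-supermodular status laws — in particular on every forest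
(blind cell PercRepro2, mine-1 g13; proofs/MINE1-W-BLOCKS.md §4, MINE1-SIDE.md §7)

`wIneqStatus_of_statusLogSupermod`: a log-supermodular status law (`StatusLogSupermod`, the FKG
lattice condition on `2^F`) satisfies the cell's W-inequality `WIneqStatus` — the abstract theorem
`WForm.wIneq_disjoint_of_logSupermod` applied to the status weight `statusW` (zero outside `2^F`).
Composed with mine-1's `statusLogSupermod_of_clusterLogSupermod` (SideCluster) and mine-c's
`ForestCluster.clusterLogSupermod_of_isForest`, this gives `wIneqStatus_of_isForest`: **the W-inequality
(the conjecture of record `WRow`) holds on every forest, for every root, avoided set and test set**,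
unconditionally in the kernel. Beyond forests the status law is log-supermodular exactly on the
triangular cacti (MINE1-LSM-CHARACTERISATION.md, Corollary B), so this route stops there; on general
graphs `WRow` remains open (census-true for n ≤ 8, |F| ≤ 4).
-/

namespace Summit.Ventures.PercRepro2

section WStatusLSM

variable {V : Type*} {E : Type*} [Fintype E] [DecidableEq E] [Fintype V] [DecidableEq V]
  {R : Type*} [CommRing R] [LinearOrder R] [IsStrictOrderedRing R]

variable {p : E → R} (ends : E → Sym2 V) (s : V) (T F : Finset V)

omit [Fintype V] in
/-- The status weight inherits the lattice condition on all of `Finset V` from `StatusLogSupermod`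
(zero outside `2^F`). -/
lemma statusW_logSupermod (hp : IsProbVec p) (hW : StatusLogSupermod p ends s T F)
    (S S' : Finset V) :
    statusW p ends s T F S * statusW p ends s T F S' ≤
      statusW p ends s T F (S ∩ S') * statusW p ends s T F (S ∪ S') := by
  unfold statusW
  by_cases hS : S ⊆ F
  · by_cases hS' : S' ⊆ F
    · rw [if_pos hS, if_pos hS', if_pos (Finset.inter_subset_left.trans hS),
        if_pos (Finset.union_subset hS hS')]
      exact hW S S' hS hS'
    · rw [if_neg hS', mul_zero]
      exact mul_nonneg (by split_ifs <;> first | exact statusMass_nonneg ends s T F hp _ | exact le_rfl)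
        (by split_ifs <;> first | exact statusMass_nonneg ends s T F hp _ | exact le_rfl)
  · rw [if_neg hS, zero_mul]
    exact mul_nonneg (by split_ifs <;> first | exact statusMass_nonneg ends s T F hp _ | exact le_rfl)
      (by split_ifs <;> first | exact statusMass_nonneg ends s T F hp _ | exact le_rfl)

/-- **A log-supermodular status law satisfies the W-inequality.** -/
theorem wIneqStatus_of_statusLogSupermod (hp : IsProbVec p)
    (hW : StatusLogSupermod p ends s T F) : WIneqStatus p ends s T F :=
  WForm.wIneq_disjoint_of_logSupermod (statusW_nonneg ends s T F hp)
    (statusW_logSupermod ends s T F hp hW)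

/-- A log-supermodular cluster law satisfies the W-inequality for every `T`, `F`. -/
theorem wIneqStatus_of_clusterLogSupermod (hp : IsProbVec p) (hc : ClusterLogSupermod p ends s) :
    WIneqStatus p ends s T F :=
  wIneqStatus_of_statusLogSupermod ends s T F hp
    (statusLogSupermod_of_clusterLogSupermod ends s hp hc T F)

/-- **The W-inequality holds on every forest** (every root, avoided set and test set) — the
conjecture of record `WRow`, unconditionally, on the class where the status law is log-supermodular
for every `F`. -/
theorem wIneqStatus_of_isForest (hp : IsProbVec p) (hF : Hull.IsForest ends) :
    WIneqStatus p ends s T F := by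
  have hc : ClusterLogSupermod p ends s := by
    have h := ForestCluster.clusterLogSupermod_of_isForest p hp hF s
    convert h
  exact wIneqStatus_of_clusterLogSupermod ends s T F hp hc

end WStatusLSM

end Summit.Ventures.PercRepro2
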